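import Summits.KontsevichZagierPeriods.Zeta5Search.LaiSweepShard

/-!
# `κ₃` sweep certificate — shard file 025 of 127 (shards 175–181 of 889)

HONEST FRAMING. Systematic search; no irrationality claim unless certified. This file only checks,
by `decide +kernel`, shards 175–181 of the order-cell sweep of the `κ₃` point `(74, 2180, 444; δ74)`
(engine `LaiSweepEngine`, soundness `LaiSweepJump/Free/Eval/Shard/Kappa3`; a shard is `⟨regime, n,
p, q, p', q', Lo, Up⟩`: `n` cells from `p/q` to `p'/q'` with integer rate sums in `[Lo, Up]`, `K =
128`, `D = 2^40`). It draws NO conclusion: only the capstone `LaiKappa3SweepCert`, which needs all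
127 shard files, does. Kernel cost of this file ≈ 560 cells × 0.3 s.
-/

namespace Summit.KontsevichZagierPeriods.Zeta5Search.Sweep

set_option maxHeartbeats 100000000 in
/-- Shard 175: 80 cells of regime B from `41/402` to `35/339`.
[cite: Lai2024BallRivoal, §4 Lemma 4.3] -/
theorem shard175 :
    Shard.check 128 (2^40)
      ⟨true, 80, 41, 402, 35, 339, 63620379974175, 64017126342905⟩ = true := by
  decide +kernel

set_option maxHeartbeats 100000000 in
/-- Shard 176: 80 cells of regime B from `35/339` to `37/354`.
[cite: Lai2024BallRivoal, §4 Lemma 4.3] -/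
theorem shard176 :
    Shard.check 128 (2^40)
      ⟨true, 80, 35, 339, 37, 354, 63831764416441, 64242763498491⟩ = true := by
  decide +kernel

set_option maxHeartbeats 100000000 in
/-- Shard 177: 80 cells of regime B from `37/354` to `31/293`.
[cite: Lai2024BallRivoal, §4 Lemma 4.3] -/
theorem shard177 :
    Shard.check 128 (2^40)
      ⟨true, 80, 37, 354, 31, 293, 63227591515915, 63648076249261⟩ = true := by
  decide +kernel

set_option maxHeartbeats 100000000 in
/-- Shard 178: 80 cells of regime B from `31/293` to `35/327`.
[cite: Lai2024BallRivoal, §4 Lemma 4.3] -/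
theorem shard178 :
    Shard.check 128 (2^40)
      ⟨true, 80, 31, 293, 35, 327, 60106532521032, 60510788862837⟩ = true := by
  decide +kernel

set_option maxHeartbeats 100000000 in
/-- Shard 179: 80 cells of regime B from `35/327` to `17/157`.
[cite: Lai2024BallRivoal, §4 Lemma 4.3] -/
theorem shard179 :
    Shard.check 128 (2^40)
      ⟨true, 80, 35, 327, 17, 157, 59975563124805, 60393327336446⟩ = true := by
  decide +kernel

set_option maxHeartbeats 100000000 in
/-- Shard 180: 80 cells of regime B from `17/157` to `23/210`.
[cite: Lai2024BallRivoal, §4 Lemma 4.3] -/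
theorem shard180 :
    Shard.check 128 (2^40)
      ⟨true, 80, 17, 157, 23, 210, 59326049002060, 59746138466453⟩ = true := by
  decide +kernel

set_option maxHeartbeats 100000000 in
/-- Shard 181: 80 cells of regime B from `23/210` to `32/289`.
[cite: Lai2024BallRivoal, §4 Lemma 4.3] -/
theorem shard181 :
    Shard.check 128 (2^40)
      ⟨true, 80, 23, 210, 32, 289, 56430589617811, 56839103893656⟩ = true := by
  decide +kernel

/-- The checked shards of this file, in order. [folklore] -/
def shards025 : List (CheckedShard 128 (2^40)) :=
  [⟨_, shard175⟩, ⟨_, shard176⟩, ⟨_, shard177⟩, ⟨_, shard178⟩, ⟨_, shard179⟩,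
    ⟨_, shard180⟩, ⟨_, shard181⟩]

end Summit.KontsevichZagierPeriods.Zeta5Search.Sweep
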